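import Summits.HodgeConjecture.CorCM.CyclicSexticFaceMonomialCarrier
import Summits.HodgeConjecture.CorCM.DiagonalInvariantComponent
import Summits.HodgeConjecture.CorCM.CyclicSexticCMTypes
import Summits.HodgeConjecture.CorCM.AndreProductFormGalois
import Literature.AlgebraicGeometry.HodgeTheory.AbelianVarietyPullbackAlgebraicClasses
import HarnessLib

/-!
# COR-CM (cell `pub-hodgecm2`), A1 line — step L5, part 2: pull-back spans, the family `h_b`, the separating
# diagonal operator, and the face-monomial coordinates

HONEST FRAMING (cell pub-hodgecm2 / COR-CM, seat b30 gen 11; COUNT-NEUTRAL — no binder row of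
`HOME/BINDER-OWNERS.md`, no case of the Hodge conjecture; nothing about algebraic cycles beyond the displayed
hypothesis `W ≤ algebraicClasses`).  The bookkeeping of step L5 of `HOME/pub-hodgecm2-lit-andre-3/A1-BLUEPRINT.md`
(PORTFOLIO-lit-andre-3-g2 §2 (S1)–(S2)) on the tree's real carriers, for four slots `A : Fin 4 → AbelianVariety ℂ`
with `𝓞_K`-actions `ι` and slot indices `j₀ j₁ j₂ j₃`, twist isogenies `u₂ : A j₂ ⟶ A j₁`, `u₃ : A j₃ ⟶ A j₁` and
`ν : A j₀ ⟶ E`: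

* `iSup_map_le_algebraicClasses`, `map_mem_iSup_map_of_comp`, `map_mem_iSup_map` — the span `V = Σ_b h_b^*(W)` of
  pull-backs of a space `W` of algebraic classes along homomorphisms `h_b : X ⟶ Y` is algebraic (Fulton 19.2 (b),
  the tree's `map_mem_algebraicClasses_of_abelianVariety`) and stable under `D^*` whenever `D ≫ h_b = h_{b′}`;
* `diagHom_comp_liftFamily`, `liftFamily_one` — the family
  `h_b = (π_{j₁} ι(b₀) + π_{j₂} ι(b₁) u₂ + π_{j₃} ι(b₂) u₃, π_{j₀} ι(b₃) ν) : ⨁ A ⟶ A j₁ ⊞ E` satisfies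
  `diag(β) ≫ h_b = h_{b·β}`;
* `exists_diag_separating_face` — for the ordered line basis of `H¹(⨁ A)` and its wedge basis of `H⁴`, some
  `β = a₀ + t ∈ 𝓞_K` (separating integer + generic shift, `InvariantComponent.exists_nat_forall_prod_add_natCast_ne`)
  acts diagonally with the eigenvalue of the face line `S_s = {(j, s)}_j` attained ONLY there;
* `repr_map_lift_map_fst`, `repr_map_lift_map_snd` — the `(j, s)`-coordinates of `h_1^*(fst^* e)` and `h_1^*(snd^* ℓ)`;
* small helpers: `apply_eq_or_eq_neg_of_sq_eq_neg` (`τ(δ) = ± i√d`), powers of `σ` of order `6`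
  (`sq_symm_apply`, `emb_comp_sq_symm`, …), `injective_vecFour`, `map_add_add_one_apply`.

THEOREMS ONLY; no `sorry`; axioms `propext`, `Classical.choice`, `Quot.sound`.

## References
* [Fulton1998] W. Fulton, *Intersection Theory* (1998), §19.2 Cor. 19.2 (b).
* [LangeBirkenhake1992] H. Lange, Ch. Birkenhake, *Complex Abelian Varieties* (1992), §1.1.
* [MoonenZarhin1998WeilClasses] B. Moonen, Yu. Zarhin, J. reine angew. Math. 496 (1998), §1 (Weil classes `W_K`).
-/

noncomputable section

namespace Summit.HodgeConjecture.CorCM.CyclicSextic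

open CategoryTheory CategoryTheory.Limits NumberField
open Literature.AlgebraicTopology.SingularHomology
open Literature.AlgebraicGeometry Literature.AlgebraicGeometry.Motives Literature.AlgebraicGeometry.HodgeTheory
open Literature.AlgebraicGeometry.ComplexMultiplication
open Literature.NumberTheory.Automorphic.PicardCM (eigenline)
open Literature.NumberTheory.Automorphic.PicardCM.CMCode (cmTypeMap mem_cmTypeMap_iff)
open Summit.HodgeConjecture.HodgeConjecture.Theorems.HodgeAbelianVarieties.CMPivotAndre

variable {K : Type} [Field K] [NumberField K] [IsCMField K] [IsGalois ℚ K]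

/-! ## The sign of `τ(δ)` -/

section Scalar

variable {k : Type} [Field k] [NumberField k]

/-- `τ(δ)² = -d` in `ℂ` when `δ² = -d` in `𝓞_k`, hence `τ(δ) = ± i√d`. [folklore] -/
theorem apply_eq_or_eq_neg_of_sq_eq_neg (τ : k →+* ℂ) {δ : 𝓞 k} {d : ℕ} (hδ : δ ^ 2 = -(d : 𝓞 k)) :
    τ (δ : k) = Complex.I * (Real.sqrt d : ℂ) ∨ τ (δ : k) = -(Complex.I * (Real.sqrt d : ℂ)) := by
  refine sq_eq_sq_iff_eq_or_eq_neg.1 ?_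
  have h : ((δ : k)) ^ 2 = -(d : k) := by
    have := congrArg (fun x : 𝓞 k => (x : k)) hδ
    push_cast at this
    exact this
  rw [I_mul_sqrt_sq, ← map_pow, h, map_neg, map_natCast]

end Scalar

/-! ## Pull-back spans of algebraic classes, stable under an endomorphism -/

section Span

variable {X Y : AbelianVariety ℂ} {I : Type*} (hfam : I → (X ⟶ Y))

/-- **A span of pull-backs of algebraic classes is algebraic** (pull-backs along homomorphisms of abelian
varieties preserve algebraic classes, Fulton 19.2 (b)). [cite: Fulton1998, §19.2 Cor. 19.2 (b)] -/
theorem iSup_map_le_algebraicClasses {p : ℕ} (W : Submodule ℂ (complexBetti Y.X (2 * p)))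
    (hW : W ≤ algebraicClasses Y.X p) :
    (⨆ b, W.map (complexBetti.map (hfam b).hom.hom.hom (2 * p)).hom) ≤ algebraicClasses X.X p := by
  refine iSup_le fun b => Submodule.map_le_iff_le_comap.mpr fun w hw => ?_
  exact map_mem_algebraicClasses_of_abelianVariety AbelianVariety.isSmoothProjective_holds Y (hfam b).hom.hom.hom
    (hW hw)

/-- `D^* ∘ h_b^* = (D ≫ h_b)^*` as linear maps on `Hᵏ`. [folklore] -/
theorem hom_map_comp_hom_map (D : X ⟶ X) (f : X ⟶ Y) (k' : ℕ) :
    (complexBetti.map D.hom.hom.hom k').hom ∘ₗ (complexBetti.map f.hom.hom.hom k').hom =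
      (complexBetti.map (D ≫ f).hom.hom.hom k').hom := by
  refine LinearMap.ext fun c => ?_
  exact abelianVarietyHom_map_map_apply D f c

/-- **Stability**: if every `D ≫ h_b` is again some `h_{b′}`, then `D^*` maps the span `Σ_b h_b^*(W)` into
itself. [folklore] -/
theorem map_mem_iSup_map_of_comp {k' : ℕ} (W : Submodule ℂ (complexBetti Y.X k')) (D : X ⟶ X)
    (hD : ∀ b, ∃ b', D ≫ hfam b = hfam b') {v : complexBetti X.X k'}
    (hv : v ∈ ⨆ b, W.map (complexBetti.map (hfam b).hom.hom.hom k').hom) :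
    complexBetti.map D.hom.hom.hom k' v ∈ ⨆ b, W.map (complexBetti.map (hfam b).hom.hom.hom k').hom := by
  have hle : (⨆ b, W.map (complexBetti.map (hfam b).hom.hom.hom k').hom).map (complexBetti.map D.hom.hom.hom k').hom
      ≤ ⨆ b, W.map (complexBetti.map (hfam b).hom.hom.hom k').hom := by
    rw [Submodule.map_iSup]
    refine iSup_le fun b => ?_
    obtain ⟨b', hb'⟩ := hD b
    rw [← Submodule.map_comp, hom_map_comp_hom_map, hb']
    exact le_iSup (fun b => W.map (complexBetti.map (hfam b).hom.hom.hom k').hom) b'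
  exact hle (Submodule.mem_map_of_mem hv)

/-- The generating pull-backs lie in the span. [folklore] -/
theorem map_mem_iSup_map {k' : ℕ} (W : Submodule ℂ (complexBetti Y.X k')) (b : I) {w : complexBetti Y.X k'}
    (hw : w ∈ W) :
    complexBetti.map (hfam b).hom.hom.hom k' w ∈ ⨆ b, W.map (complexBetti.map (hfam b).hom.hom.hom k').hom :=
  (le_iSup (fun b => W.map (complexBetti.map (hfam b).hom.hom.hom k').hom) b) (Submodule.mem_map_of_mem hw)

end Span

/-! ## Helpers on `σ`, `emb`, vectors of four distinct entries, sums of pull-backs -/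

section Helpers

variable (σ : K ≃ₐ[ℚ] K)

omit [IsCMField K] [IsGalois ℚ K] in
/-- `(σ²)⁻¹ = σ⁴` on elements, for `σ` of order `6`. [folklore] -/
theorem sq_symm_apply (hσ : orderOf σ = 6) (x : K) : (σ ^ 2).symm x = (σ ^ 4) x := by
  have h6 : σ ^ 6 = 1 := by rw [← hσ]; exact pow_orderOf_eq_one σ
  have h : (σ ^ 2) ((σ ^ 4) x) = x := by
    rw [← AlgEquiv.mul_apply, ← pow_add, show 2 + 4 = 6 from rfl, h6, AlgEquiv.one_apply]
  conv_lhs => rw [← h]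
  rw [AlgEquiv.symm_apply_apply]

omit [IsCMField K] [IsGalois ℚ K] in
/-- `(σ⁴)⁻¹ = σ²` on elements, for `σ` of order `6`. [folklore] -/
theorem pow_four_symm_apply (hσ : orderOf σ = 6) (x : K) : (σ ^ 4).symm x = (σ ^ 2) x := by
  have h6 : σ ^ 6 = 1 := by rw [← hσ]; exact pow_orderOf_eq_one σ
  have h : (σ ^ 4) ((σ ^ 2) x) = x := by
    rw [← AlgEquiv.mul_apply, ← pow_add, show 4 + 2 = 6 from rfl, h6, AlgEquiv.one_apply]
  conv_lhs => rw [← h]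
  rw [AlgEquiv.symm_apply_apply]

omit [IsCMField K] [IsGalois ℚ K] in
/-- `(p ∘ σᵃ) ∘ (σ²)⁻¹ = p ∘ σ^{a+4}`. [folklore] -/
theorem emb_comp_sq_symm (hσ : orderOf σ = 6) (p : K →+* ℂ) (a : ℕ) :
    (emb σ p a).comp (σ ^ 2).toRingEquiv.symm.toRingHom = emb σ p (a + 4) := by
  rw [← emb_comp_pow σ p a 4]
  refine RingHom.ext fun x => ?_
  change emb σ p a ((σ ^ 2).toRingEquiv.symm x) = emb σ p a ((σ ^ 4).toRingEquiv x)
  exact congrArg (emb σ p a) (sq_symm_apply σ hσ x)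

omit [IsCMField K] [IsGalois ℚ K] in
/-- `(p ∘ σᵃ) ∘ (σ⁴)⁻¹ = p ∘ σ^{a+2}`. [folklore] -/
theorem emb_comp_pow_four_symm (hσ : orderOf σ = 6) (p : K →+* ℂ) (a : ℕ) :
    (emb σ p a).comp (σ ^ 4).toRingEquiv.symm.toRingHom = emb σ p (a + 2) := by
  rw [← emb_comp_pow σ p a 2]
  refine RingHom.ext fun x => ?_
  change emb σ p a ((σ ^ 4).toRingEquiv.symm x) = emb σ p a ((σ ^ 2).toRingEquiv x)
  exact congrArg (emb σ p a) (pow_four_symm_apply σ hσ x)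

omit [IsCMField K] in
/-- `p ∘ σᵃ ≠ p` when `6 ∤ a`. [folklore] -/
theorem emb_ne_self (hσ : orderOf σ = 6) (p : K →+* ℂ) {a : ℕ} (ha : a % 6 ≠ 0) : emb σ p a ≠ p := by
  intro h
  have h' : emb σ p a = emb σ p 0 := h.trans (emb_zero σ p).symm
  rw [emb_eq_emb_iff σ p hσ] at h'
  exact ha (by simpa using h')

omit [IsCMField K] [IsGalois ℚ K] in
/-- `p ∘ σ⁶ = p`. [folklore] -/
theorem emb_six (hσ : orderOf σ = 6) (p : K →+* ℂ) : emb σ p 6 = p := by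
  rw [← emb_mod σ p hσ 6]
  exact emb_zero σ p

end Helpers

section Vec

/-- A vector of four pairwise distinct entries is injective. [folklore] -/
theorem injective_vecFour {α : Type*} {a b c d : α} (hab : a ≠ b) (hac : a ≠ c) (had : a ≠ d) (hbc : b ≠ c)
    (hbd : b ≠ d) (hcd : c ≠ d) : Function.Injective (![a, b, c, d] : Fin 4 → α) := by
  intro i j h
  fin_cases i <;> fin_cases j <;> simp_all

end Vec

section PullbackSum

variable {X Y : AbelianVariety ℂ}

/-- `(f + g + h)^* e = f^* e + g^* e + h^* e` on `H¹`. [cite: LangeBirkenhake1992, §1.1 (p. 19)] -/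
theorem map_add_add_one_apply (f g h : X ⟶ Y) (e : complexBetti Y.X 1) :
    complexBetti.map (f + g + h).hom.hom.hom 1 e =
      complexBetti.map f.hom.hom.hom 1 e + complexBetti.map g.hom.hom.hom 1 e + complexBetti.map h.hom.hom.hom 1 e := by
  rw [complexBetti_map_add_one, complexBetti_map_add_one]
  rfl

end PullbackSum

/-! ## The family `h_b : ⨁ A ⟶ A_{j₁} ⊞ E` and its equivariance under the diagonal action -/

section Family

variable {A : Fin 4 → AbelianVariety ℂ} (ι : ∀ j, 𝓞 K →+* End (A j))
variable {j₀ j₁ j₂ j₃ : Fin 4} {E : AbelianVariety ℂ} (u₂ : A j₂ ⟶ A j₁) (u₃ : A j₃ ⟶ A j₁) (ν : A j₀ ⟶ E)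

omit [NumberField K] [IsCMField K] [IsGalois ℚ K] in
/-- **`diag(β) ≫ h_b = h_{b·β}`**: the diagonal `𝓞_K`-action permutes the family `h_b` (the `ι`'s sit before the
twist isogenies, `biproduct.map_π`, `ι(c) * ι(β) = ι(β) ≫ ι(c)`). [folklore] -/
theorem diagHom_comp_liftFamily (β : 𝓞 K) (b : Fin 4 → 𝓞 K) :
    AndreProductForm.diagHom K A ι β ≫
        biprod.lift (biproduct.π A j₁ ≫ ι j₁ (b 0) + biproduct.π A j₂ ≫ ι j₂ (b 1) ≫ u₂ +
            biproduct.π A j₃ ≫ ι j₃ (b 2) ≫ u₃)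
          (biproduct.π A j₀ ≫ ι j₀ (b 3) ≫ ν) =
      biprod.lift (biproduct.π A j₁ ≫ ι j₁ (b 0 * β) + biproduct.π A j₂ ≫ ι j₂ (b 1 * β) ≫ u₂ +
            biproduct.π A j₃ ≫ ι j₃ (b 2 * β) ≫ u₃)
          (biproduct.π A j₀ ≫ ι j₀ (b 3 * β) ≫ ν) := by
  have key : ∀ (j : Fin 4) (c : 𝓞 K) {Z : AbelianVariety ℂ} (f : A j ⟶ Z),
      AndreProductForm.diagHom K A ι β ≫ (biproduct.π A j ≫ ι j c ≫ f) = biproduct.π A j ≫ ι j (c * β) ≫ f := by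
    intro j c Z f
    rw [biproduct.map_π_assoc, map_mul, End.mul_def, Category.assoc]
  have key' : ∀ (j : Fin 4) (c : 𝓞 K),
      AndreProductForm.diagHom K A ι β ≫ (biproduct.π A j ≫ ι j c) = biproduct.π A j ≫ ι j (c * β) := by
    intro j c
    have h := key j c (𝟙 (A j))
    simp only [Category.comp_id] at h
    exact h
  apply biprod.hom_ext
  · simp only [Category.assoc, biprod.lift_fst, Preadditive.comp_add, key, key']
  · simp only [Category.assoc, biprod.lift_snd, key]

omit [NumberField K] [IsCMField K] [IsGalois ℚ K] in
/-- The member `b = 1` of the family: `h_1 = (π_{j₁} + π_{j₂} u₂ + π_{j₃} u₃, π_{j₀} ν)`. [folklore] -/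
theorem liftFamily_one :
    biprod.lift (biproduct.π A j₁ ≫ ι j₁ ((1 : Fin 4 → 𝓞 K) 0) +
          biproduct.π A j₂ ≫ ι j₂ ((1 : Fin 4 → 𝓞 K) 1) ≫ u₂ + biproduct.π A j₃ ≫ ι j₃ ((1 : Fin 4 → 𝓞 K) 2) ≫ u₃)
        (biproduct.π A j₀ ≫ ι j₀ ((1 : Fin 4 → 𝓞 K) 3) ≫ ν) =
      biprod.lift (biproduct.π A j₁ + biproduct.π A j₂ ≫ u₂ + biproduct.π A j₃ ≫ u₃) (biproduct.π A j₀ ≫ ν) := by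
  simp only [Pi.one_apply, map_one, End.one_def, Category.id_comp, Category.comp_id]

end Family

/-! ## A separating diagonal operator for the face line -/

section Separating

variable {A : Fin 4 → AbelianVariety ℂ} {ι : ∀ j, 𝓞 K →+* End (A j)}
  {θ : ∀ j, K →+* Module.End ℂ (complexBetti (A j).X 1)} {Ψ : Fin 4 → CMType K}
  {v : ∀ j, Module.Basis (K →+* ℂ) ℂ (complexBetti (A j).X 1)}

omit [IsCMField K] [IsGalois ℚ K] in
/-- **Separating the face line by ONE diagonal operator.**  For an ordered line basis `L` of `H¹(⨁ A)`
(`L i = π^* v` reindexed by `Fin 4 ×ₗ (K → ℂ)`), its wedge basis `Bw` of `H⁴`, and the face index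
`S_s = {(0,s),(1,s),(2,s),(3,s)}` (`fS`): there is `β ∈ 𝓞_K` such that `diag(β)^*` is diagonal on `Bw` with an
eigenvalue function `lam` taking the value `lam S_s` ONLY at `S_s` (`β = a₀ + t`, `a₀` separating the embeddings,
`t` a generic natural shift: `exists_nat_forall_prod_add_natCast_ne`). [cite: MoonenZarhin1998WeilClasses, §1] -/
theorem exists_diag_separating_face [LinearOrder (K →+* ℂ)]
    (hA : ∀ j, IsCMTypeRealisation (Ψ j) (A j) (ι j) (θ j)) (hv : ∀ j σ', v j σ' ∈ eigenline (θ j) σ')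
    (L : Module.Basis (Fin 4 ×ₗ (K →+* ℂ)) ℂ (complexBetti (⨁ A).X 1))
    (hL : ∀ i, L i = AndreProductForm.biprodBasis A v (ofLex i))
    (Bw : Module.Basis (Set.powersetCard (Fin 4 ×ₗ (K →+* ℂ)) (2 * 2)) ℂ (complexBetti (⨁ A).X (2 * 2)))
    (hBw : Bw = (L.exteriorPower (2 * 2)).map
      ((AbelianVariety.hasExteriorCohomologyH1_complexPoints (⨁ A)).equiv (2 * 2)))
    (s : K →+* ℂ) (fS : Fin (2 * 2) ↪o Fin 4 ×ₗ (K →+* ℂ)) (hfS : ∀ j, fS j = toLex (j, s)) :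
    ∃ (β : 𝓞 K) (lam : Set.powersetCard (Fin 4 ×ₗ (K →+* ℂ)) (2 * 2) → ℂ),
      (∀ S, complexBetti.map (AndreProductForm.diagHom K A ι β).hom.hom.hom (2 * 2) (Bw S) = lam S • Bw S) ∧
      ∀ S, lam S = lam (Set.powersetCard.ofFinEmbEquiv fS) → S = Set.powersetCard.ofFinEmbEquiv fS := by
  classical
  set Ss := Set.powersetCard.ofFinEmbEquiv fS with hSs
  have hmemSs : ∀ i, i ∈ (Ss : Finset (Fin 4 ×ₗ (K →+* ℂ))) ↔ (ofLex i).2 = s := by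
    intro i
    rw [Set.powersetCard.mem_coe_iff, hSs, Set.powersetCard.mem_ofFinEmbEquiv_iff_mem_range]
    constructor
    · rintro ⟨j, hj⟩
      rw [← hj, hfS]; rfl
    · intro hi
      refine ⟨(ofLex i).1, ?_⟩
      rw [hfS, ← hi]; rfl
  obtain ⟨a₀, hsep⟩ := AndreProductForm.exists_integer_separating (K := K)
  -- the multisets of `a₀`-values over `S ≠ S_s` differ from `4 × s(a₀)`
  have hM : ∀ S : {S : Set.powersetCard (Fin 4 ×ₗ (K →+* ℂ)) (2 * 2) // S ≠ Ss},
      ((S.1 : Finset (Fin 4 ×ₗ (K →+* ℂ))).val.map fun i => (ofLex i).2 (a₀ : K)) ≠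
        Multiset.replicate (2 * 2) (s (a₀ : K)) := by
    rintro ⟨S, hS⟩ hrep
    apply hS
    rw [Set.powersetCard.eq_iff_subset]
    intro i hi
    have hmem : (ofLex i).2 (a₀ : K) ∈ Multiset.replicate (2 * 2) (s (a₀ : K)) := by
      rw [← hrep]; exact Multiset.mem_map_of_mem _ (Finset.mem_def.mp hi)
    exact (hmemSs i).2 (hsep (Multiset.eq_of_mem_replicate hmem))
  obtain ⟨tt, htt⟩ := InvariantComponent.exists_nat_forall_prod_add_natCast_ne _ _ hM
  refine ⟨a₀ + (tt : 𝓞 K), fun S => ∏ i ∈ (S : Finset (Fin 4 ×ₗ (K →+* ℂ))), (ofLex i).2 ((a₀ : K) + tt), ?_, ?_⟩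
  · intro S
    have hβK : ((a₀ + (tt : 𝓞 K) : 𝓞 K) : K) = (a₀ : K) + tt := by push_cast; rfl
    refine WedgeCoordinates.map_wedgeBasis_of_diagonal L (2 * 2) Bw hBw (AndreProductForm.diagHom K A ι _)
      (fun i => (ofLex i).2 ((a₀ : K) + tt)) (fun i => ?_) S
    rw [hL i, ← hβK]
    exact AndreProductForm.map_diagHom_biprodBasis K A ι hA hv _ (ofLex i).1 (ofLex i).2
  · intro S hS
    have hS' : ∏ i ∈ (S : Finset (Fin 4 ×ₗ (K →+* ℂ))), (ofLex i).2 ((a₀ : K) + tt) =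
        ∏ i ∈ (Ss : Finset (Fin 4 ×ₗ (K →+* ℂ))), (ofLex i).2 ((a₀ : K) + tt) := hS
    by_contra hne
    apply htt ⟨S, hne⟩
    have hval : ∀ S : Set.powersetCard (Fin 4 ×ₗ (K →+* ℂ)) (2 * 2),
        (∏ i ∈ (S : Finset (Fin 4 ×ₗ (K →+* ℂ))), (ofLex i).2 ((a₀ : K) + tt)) =
          (((S : Finset (Fin 4 ×ₗ (K →+* ℂ))).val.map fun i => (ofLex i).2 (a₀ : K)).map
            fun m => m + (tt : ℂ)).prod := by
      intro S
      rw [Finset.prod_eq_multiset_prod, Multiset.map_map]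
      congr 1
      refine Multiset.map_congr rfl fun i _ => ?_
      simp [map_add, map_natCast]
    have hSsval : ((Ss : Finset (Fin 4 ×ₗ (K →+* ℂ))).val.map fun i => (ofLex i).2 (a₀ : K)) =
        Multiset.replicate (2 * 2) (s (a₀ : K)) := by
      have h1 : (Ss : Finset (Fin 4 ×ₗ (K →+* ℂ))).val = Finset.univ.val.map fS := by
        rw [hSs, Set.powersetCard.ofFinEmbEquiv_apply]
        change (Subtype.val (Set.powersetCard.ofFinEmb (2 * 2) _ fS.toEmbedding)).val = _
        rw [Set.powersetCard.val_ofFinEmb]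
        rfl
      rw [h1, Multiset.map_map]
      have h2 : ((fun i => (ofLex i).2 (a₀ : K)) ∘ (fS : Fin (2 * 2) → Fin 4 ×ₗ (K →+* ℂ))) =
          fun _ => s (a₀ : K) := by
        funext j
        simp only [Function.comp_apply, hfS]
        rfl
      rw [h2, Multiset.map_const', Finset.card_val, Finset.card_univ, Fintype.card_fin]
    rw [← hval S, hS', hval Ss, hSsval]

end Separating

/-! ## The face-monomial coordinate of the pulled-back Weil class -/

section Coordinate

variable {A : Fin 4 → AbelianVariety ℂ} {ι : ∀ j, 𝓞 K →+* End (A j)}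
  {θ : ∀ j, K →+* Module.End ℂ (complexBetti (A j).X 1)} {Ψ : Fin 4 → CMType K}
  {v : ∀ j, Module.Basis (K →+* ℂ) ℂ (complexBetti (A j).X 1)}
variable {j₀ j₁ j₂ j₃ : Fin 4} {E : AbelianVariety ℂ} {u₂ : A j₂ ⟶ A j₁} {u₃ : A j₃ ⟶ A j₁} {ν : A j₀ ⟶ E}

omit [IsCMField K] [IsGalois ℚ K] in
/-- Coordinates of `h_1^*(fst^* e)` on the `s`-lines: contributions of the three primitive slots.
[cite: LangeBirkenhake1992, §1.1 (p. 19)] -/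
theorem repr_map_lift_map_fst (e : complexBetti (A j₁).X 1) (j : Fin 4) (s : K →+* ℂ) :
    (AndreProductForm.biprodBasis A v).repr
        (complexBetti.map
          (biprod.lift (biproduct.π A j₁ + biproduct.π A j₂ ≫ u₂ + biproduct.π A j₃ ≫ u₃)
            (biproduct.π A j₀ ≫ ν)).hom.hom.hom 1
          (complexBetti.map (biprod.fst : A j₁ ⊞ E ⟶ A j₁).hom.hom.hom 1 e)) (j, s) =
      (if j = j₁ then (v j₁).repr e s else 0) +
        (if j = j₂ then (v j₂).repr (complexBetti.map u₂.hom.hom.hom 1 e) s else 0) +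
        (if j = j₃ then (v j₃).repr (complexBetti.map u₃.hom.hom.hom 1 e) s else 0) := by
  classical
  rw [complexBetti_map_map_one_apply, biprod.lift_fst, map_add_add_one_apply, map_add, map_add,
    Finsupp.add_apply, Finsupp.add_apply, WedgeCoordinates.biprodBasis_repr_map_π,
    ← complexBetti_map_map_one_apply, WedgeCoordinates.biprodBasis_repr_map_π,
    ← complexBetti_map_map_one_apply, WedgeCoordinates.biprodBasis_repr_map_π]

omit [IsCMField K] [IsGalois ℚ K] in
/-- Coordinates of `h_1^*(snd^* ℓ)` on the `s`-lines: the induced slot only. [cite: LangeBirkenhake1992, §1.1 (p. 19)] -/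
theorem repr_map_lift_map_snd (ℓ : complexBetti E.X 1) (j : Fin 4) (s : K →+* ℂ) :
    (AndreProductForm.biprodBasis A v).repr
        (complexBetti.map
          (biprod.lift (biproduct.π A j₁ + biproduct.π A j₂ ≫ u₂ + biproduct.π A j₃ ≫ u₃)
            (biproduct.π A j₀ ≫ ν)).hom.hom.hom 1
          (complexBetti.map (biprod.snd : A j₁ ⊞ E ⟶ E).hom.hom.hom 1 ℓ)) (j, s) =
      if j = j₀ then (v j₀).repr (complexBetti.map ν.hom.hom.hom 1 ℓ) s else 0 := by
  classical
  rw [complexBetti_map_map_one_apply, biprod.lift_snd, ← complexBetti_map_map_one_apply,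
    WedgeCoordinates.biprodBasis_repr_map_π]

end Coordinate

end Summit.HodgeConjecture.CorCM.CyclicSextic

end
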